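import Literature.Algebra.Lie.SemisimpleSmallDimension
import HarnessLib

/-!
# A semisimple Lie algebra of dimension `< 6` is simple (of dimension `3`)

Topic `Literature/Algebra/Lie`. Theorems only (no definition, no named fact, D-0026), Mathlib vocabulary
(`LieAlgebra.IsSemisimple`, `LieAlgebra.IsSimple`). Written for the cell `pub-hodgecm2` (COR-CM), seat `b27` (count-neutral own lane
MT-REDUCTIVE): the semisimple part `[Lie Hg, Lie Hg]` of the Hodge Lie algebra of a complex abelian variety with `dim MT(H¹X) ≤ 6`
is three-dimensional (`CorCM/MumfordTateRankSix`), hence SIMPLE.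

PRINTED RESULT. J. E. Humphreys, GTM 9, §5.2 Thm. («`L` semisimple ⟹ `L = L₁ ⊕ … ⊕ L_t`, simple ideals») with §8.4 (each
simple `Lᵢ` has dimension `rankᵢ + #rootsᵢ ≥ 3`): a semisimple Lie algebra of dimension `< 6` has exactly one simple summand.
Folklore consequence; the dimension bound for the summands is the tree's `SemisimpleSmallDimension.finrank_ne_of_hasTrivialRadical`.

RESULTS (namespace `Literature.Algebra.Lie.SemisimpleSmallDimension`, field `K` of characteristic `0`, `L` finite-dimensional):
* `three_le_finrank_of_isAtom` — every minimal (simple) ideal of a semisimple `L` has dimension `≥ 3`;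
* **`isSimple_of_finrank_lt_six`** — `L` semisimple, `0 < dim L < 6` ⟹ `L` simple (a proper atom `A` has the complementary ideal
  `Aᶜ ≠ 0` in the Boolean algebra of ideals, and `dim A + dim Aᶜ = dim L` would be `≥ 6`);
* `isSimple_of_finrank_eq_three` — in particular a semisimple Lie algebra of dimension `3` is simple;
* `finrank_eq_three_of_finrank_lt_six` — and a non-zero semisimple Lie algebra of dimension `< 6` has dimension `3`.

## References
* [Humphreys1972] J. E. Humphreys, *Introduction to Lie Algebras and Representation Theory*, GTM 9 (1972), §5.2, §8.4.
-/

namespace Literature.Algebra.Lie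

namespace SemisimpleSmallDimension

open LieAlgebra Module

variable {K L : Type*} [Field K] [CharZero K] [LieRing L] [LieAlgebra K L] [FiniteDimensional K L]

/-- **Every atom (minimal non-zero ideal) of a semisimple Lie algebra has dimension `≥ 3`**: it is a simple Lie algebra
(`LieAlgebra.IsSemisimple.isSimple_of_isAtom`), hence semisimple with trivial radical, so its dimension is not `1` or `2`
(`finrank_ne_of_hasTrivialRadical`), and it is non-zero. [cite: Humphreys1972, §8.4] [cite: Humphreys1972, §5.2] -/
theorem three_le_finrank_of_isAtom [LieAlgebra.IsSemisimple K L] {A : LieIdeal K L} (hA : IsAtom A) :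
    3 ≤ finrank K A := by
  haveI : LieAlgebra.IsSimple K A := LieAlgebra.IsSemisimple.isSimple_of_isAtom A hA
  haveI : Module.Finite K A := Module.Finite.of_injective A.toSubmodule.subtype Subtype.val_injective
  have h := finrank_ne_of_hasTrivialRadical (K := K) (L := A)
  have h0 : finrank K A ≠ 0 := by
    intro h0
    apply hA.1
    rw [← LieSubmodule.toSubmodule_eq_bot]
    exact Submodule.finrank_eq_zero.1 h0
  omega

/-- **A semisimple Lie algebra of dimension `< 6` over a field of characteristic `0` is simple** (its dimension is then `3`).
Take an atom `A` (the lattice of ideals of a semisimple Lie algebra is an atomistic Boolean algebra); if `A ≠ ⊤` then its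
complement `Aᶜ` is a non-zero ideal, contains an atom, and `dim A + dim Aᶜ = dim L ≥ 3 + 3`. [cite: Humphreys1972, §5.2]
[cite: Humphreys1972, §8.4] -/
theorem isSimple_of_finrank_lt_six [LieAlgebra.IsSemisimple K L] (h0 : 0 < finrank K L) (h6 : finrank K L < 6) :
    LieAlgebra.IsSimple K L := by
  haveI : Nontrivial L := Module.finrank_pos_iff.1 h0
  -- `L` is not abelian
  have hL : ¬ IsLieAbelian L := by
    intro hab
    haveI := hab
    have : Subsingleton L := LieAlgebra.subsingleton_of_hasTrivialRadical_lie_abelian K L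
    exact not_subsingleton L this
  rw [← LieAlgebra.isSimple_iff_of_not_isLieAbelian K L hL]
  -- every non-zero ideal is `⊤`
  refine ⟨fun I => ?_⟩
  rcases eq_bot_or_exists_atom_le I with hI | ⟨A, hA, hAI⟩
  · exact Or.inl hI
  · right
    -- the atom `A` is everything
    have hAtop : A = ⊤ := by
      by_contra hne
      have h3A := three_le_finrank_of_isAtom (K := K) hA
      -- the complement ideal is non-zero and contains an atom
      have hc : IsCompl A Aᶜ := isCompl_compl
      have hAc : Aᶜ ≠ ⊥ := by
        intro hbot
        apply hne
        have := hc.sup_eq_top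
        rwa [hbot, sup_bot_eq] at this
      obtain ⟨B, hB, hBA⟩ := (eq_bot_or_exists_atom_le Aᶜ).resolve_left hAc
      have h3B := three_le_finrank_of_isAtom (K := K) hB
      have hBle : finrank K B ≤ finrank K (Aᶜ : LieIdeal K L) :=
        Submodule.finrank_mono (show (B : Submodule K L) ≤ (Aᶜ : LieIdeal K L) from hBA)
      -- dimensions add up along the complementary pair
      have hsum : finrank K (A : Submodule K L) + finrank K ((Aᶜ : LieIdeal K L) : Submodule K L) = finrank K L := by
        have hc' : IsCompl (A : Submodule K L) ((Aᶜ : LieIdeal K L) : Submodule K L) :=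
          LieSubmodule.isCompl_toSubmodule.2 hc
        have h1 := Submodule.finrank_sup_add_finrank_inf_eq (A : Submodule K L) ((Aᶜ : LieIdeal K L) : Submodule K L)
        rw [hc'.sup_eq_top, hc'.inf_eq_bot, finrank_top, finrank_bot, add_zero] at h1
        exact h1.symm
      have e1 : finrank K (A : Submodule K L) = finrank K A := rfl
      have e2 : finrank K ((Aᶜ : LieIdeal K L) : Submodule K L) = finrank K (Aᶜ : LieIdeal K L) := rfl
      omega
    rw [hAtop] at hAI
    exact top_le_iff.1 hAI

/-- **A semisimple Lie algebra of dimension `3` is simple.** [cite: Humphreys1972, §5.2] -/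
theorem isSimple_of_finrank_eq_three [LieAlgebra.IsSemisimple K L] (h3 : finrank K L = 3) : LieAlgebra.IsSimple K L :=
  isSimple_of_finrank_lt_six (by omega) (by omega)

/-- **A non-zero semisimple Lie algebra of dimension `< 6` has dimension `3`.** [cite: Humphreys1972, §8.4] -/
theorem finrank_eq_three_of_finrank_lt_six [LieAlgebra.IsSemisimple K L] (h0 : 0 < finrank K L) (h6 : finrank K L < 6) :
    finrank K L = 3 := by
  have h := finrank_ne_of_hasTrivialRadical (K := K) (L := L)
  omega

end SemisimpleSmallDimension

end Literature.Algebra.Lie
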